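import Summits.HodgeConjecture.HodgeConjecture.Theorems.VHCAbelianSchemesRoadSecantQuotientResidualSpecialFibrePrime
import Literature.AlgebraicGeometry.HodgeTheory.ExpTwistClassesComposition
import HarnessLib

/-!
# Road b02 (`VHCAbelianSchemesRoad`, D-0059) — THE ROOT CALCULUS OF FLAG-TYPE CARRIERS: Chern data `ch(F) = Σ_a exp(ℓ_a)` in Markman's
# gauge are the power sums of the CENTRED roots, and the `(6,3)` find-the-sheaf problem of lane R in FLAG-ROOT FORM
# (stub `stub_residual_63_secantQuotientPinnedPrime` of the re-keyed crux `SemiregularSheafRepresentativesTwPrimeAtDiag`, item stmt-HodgeConjecture-20707)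

research route conditional on HC_CM; not a corollary; Q11.4-sentence-2 already refuted in dim ≥ 3.

FACT-FREE, 0 def, no named fact, `HC_CM` nowhere (ring2-b03 gen 86 = director-hodge R10.1 (S1): lane-R stub-worker of record on
`stub_residual_63_secantQuotientPinnedPrime`; DESIGN FIRST — this file is the kernel side of the design pass `S1-DESIGN-PASS-g86.md` on the item).
A FLAG-TYPE datum is a finite locally free `F` whose Chern character is that of a sum of line bundles, `ch_j(F) = Σ_a (1/j!) ℓ_aʲ` for classes
`ℓ_a ∈ H²` («Chern roots»; e.g. `F` filtered with invertible graded pieces, by `ChernCharacterBetti.ch_shortExact` + `ch_of_hasRankLE_one`).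

* §1 ROOT CALCULUS (pure cohomology, from the exponential law `expTwistClasses_add` — `ExpTwistClassesExponentialLaw`, ring2-b06 g123 p555680 — and this
  lineage's operator/consumer module `ExpTwistClassesComposition` (p555993 v2 = p558558, which imports it): `(exp(ℓ) ∪ δ)_k = ℓᵏ/k!` for the unit family
  `δ = exp(0)`; the DIVIDED-POWER BINOMIAL THEOREM `(exp(B) ∪ exp(ℓ))_k = (ℓ + B)ᵏ/k!`; the twist commutes with finite sums of families
  (additivity/homogeneity are p555680's `expTwistClasses_add_family` / `_smul_family`); hence
  `(exp(B) ∪ Σ_a exp(ℓ_a))_k = Σ_a (ℓ_a + B)ᵏ/k!`.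
* §2 MARKMAN'S GAUGE ON ROOT DATA: `ch₀(F) = m·1`, `ch₁(F) = Σ_a ℓ_a`, and for `B_M = −ch₁(F)/m`:
  `κ_k(F) = (exp(B_M) ∪ ch(F))_k = Σ_a μ_aᵏ/k!` with the CENTRED roots `μ_a = ℓ_a − (1/m)Σ_b ℓ_b` (`expTwistCh_markman_eq_sum_centredRoots`).
* §3 THE `(6,3)` FIND-THE-SHEAF PROBLEM IN FLAG-ROOT FORM: at elliptic-power (resp. Lefschetz-fibre) anchors, flag-type `F` that are
  `{0,1,2}`-semiregular with `½Σ_a μ_a² = c₂·θ²` and `(1/6)Σ_a μ_a³ = a·w + c₃·θ³`, `a ≠ 0`, give the primed carrier statements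
  (`ellipticPowerCarrierAt63_twAdm'_of_forall_exists_flagRoots`, `lefschetzCarrierAt63_twAdm'_of_forall_exists_flagRoots`) — by gen 85's
  Markman-normalised constructors. So on the Buchweitz–Flenner disjunct the lane-R design problem for flag-type objects is: integral Hermitian root
  systems with `p₁ = 0`, `p₂ ∝ θ²`, `p₃ ≡ a·w (mod θ³)` (+ the deformation-necessary `p₄ ∝ θ⁴`, `p₅ ∝ θ⁵`), AND `{0,1,2}`-semiregularity of a bundle
  with those roots — the memo's conditions (R1)–(R5), (I), (S); the memo exhibits integral solutions of the class conditions at `E⁶` for Lefschetz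
  directions `x_j·θ²` (3 roots, diagonal-model semiregular) and for the WEIL direction at `E³ × Ē³` (32 roots, `κ = 32 − 32·w`, semiregularity open).

Nothing here says any carrier statement, cell, rung, crux, K-SR♭∃, VHC, `HC_AV` or HC holds.
References: [cite: HuybrechtsStellari2005, §1] [cite: Markman2025SecantWeil, §1.1 (κ-class), §7.3 and Lemma 9.3.6] [cite: Fulton1998, Example 3.2.3 and §15.1]
[cite: BuchweitzFlenner2003, §5 (I-semiregular) and Thm. 5.1] [cite: Pridham2024Semiregularity, Cor. 2.25 and Rem. 2.26] [cite: HatcherAT2002, §3.2].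
-/

noncomputable section

open CategoryTheory CategoryTheory.Limits AlgebraicGeometry Topology

-- the cell's namespace repeats the summit name (`Summit.HodgeConjecture.HodgeConjecture…`), as in every `Ring2*` file
set_option linter.dupNamespace false

namespace Summit.HodgeConjecture.HodgeConjecture.Ring2.SemiregularRepresentatives

open Literature.AlgebraicGeometry Literature.AlgebraicGeometry.Motives Literature.AlgebraicGeometry.Modules
open Literature.AlgebraicGeometry.HodgeTheory
open Literature.AlgebraicTopology.SingularHomology
open Literature.Barriers.HodgeConjecture (divisorClassesSpan)
open Summit.Ventures.HSemireg (ObjClass)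

/-! ## §1 Root calculus -/

section Roots

variable {X : SchemeOver ℂ}

/-- `0ʲ = 0` for `j > 0` (cup powers of the zero class). [cite: HatcherAT2002, §3.2] -/
theorem cupPowTwo_zero_eq_zero_of_pos {j : ℕ} (hj : 0 < j) : cupPowTwo (0 : complexBetti X 2) j = 0 := by
  obtain ⟨j, rfl⟩ := Nat.exists_eq_succ_of_ne_zero hj.ne'
  rw [cupPowTwo_succ, map_zero]

/-- **The unit family is `exp(0)`, and `(exp(ℓ) ∪ exp(0))_k = ℓᵏ/k!`**: twisting the unit family `(1, 0, 0, …) = ((1/j!)·0ʲ)_j` by `ℓ`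
gives the exponential family of `ℓ` (only the term `i = k` of the defining sum survives). [cite: HuybrechtsStellari2005, §1] -/
theorem expTwistClasses_expFamily_zero (ℓ : complexBetti X 2) (k : ℕ) :
    expTwistClasses X ℓ (fun j => ((Nat.factorial j : ℕ) : ℂ)⁻¹ • cupPowTwo (0 : complexBetti X 2) j) k =
      ((Nat.factorial k : ℕ) : ℂ)⁻¹ • cupPowTwo ℓ k := by
  unfold expTwistClasses
  rw [Fin.sum_univ_castSucc, Finset.sum_eq_zero fun i _ => ?_, zero_add]
  · show ((Nat.factorial k : ℕ) : ℂ)⁻¹ • cupProduct _ (cupPowTwo ℓ k)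
        ((fun j => ((Nat.factorial j : ℕ) : ℂ)⁻¹ • cupPowTwo (0 : complexBetti X 2) j) (k - k)) = _
    rw [cupProduct_family_congr (cupPowTwo ℓ k) (fun j => ((Nat.factorial j : ℕ) : ℂ)⁻¹ • cupPowTwo (0 : complexBetti X 2) j)
      (Nat.sub_self k) _ (by omega : 2 * k + 2 * 0 = 2 * k)]
    show ((Nat.factorial k : ℕ) : ℂ)⁻¹ • cupProduct _ (cupPowTwo ℓ k)
        (((Nat.factorial 0 : ℕ) : ℂ)⁻¹ • cupPowTwo (0 : complexBetti X 2) 0) = _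
    rw [Nat.factorial_zero, Nat.cast_one, inv_one, one_smul, cupPowTwo_zero]
    exact congrArg _ (cupProduct_one _)
  · have hi : 0 < k - ((Fin.castSucc i : Fin (k + 1)) : ℕ) := by rw [Fin.val_castSucc]; omega
    show _ • cupProduct _ (cupPowTwo ℓ _) (((Nat.factorial (k - ((Fin.castSucc i : Fin (k + 1)) : ℕ)) : ℕ) : ℂ)⁻¹ •
        cupPowTwo (0 : complexBetti X 2) (k - ((Fin.castSucc i : Fin (k + 1)) : ℕ))) = 0
    rw [cupPowTwo_zero_eq_zero_of_pos hi, smul_zero, map_zero, smul_zero]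

/-- **THE DIVIDED-POWER BINOMIAL THEOREM**: `(exp(B) ∪ exp(ℓ))_k = (ℓ + B)ᵏ/k!` — the twist by `B` of the exponential family of `ℓ` is the
exponential family of `ℓ + B` (`exp(B) exp(ℓ) = exp(ℓ + B)` for the commuting degree-`2` classes `ℓ, B`; from the composition law).
[cite: HuybrechtsStellari2005, §1] -/
theorem expTwistClasses_expFamily (B ℓ : complexBetti X 2) (k : ℕ) :
    expTwistClasses X B (fun j => ((Nat.factorial j : ℕ) : ℂ)⁻¹ • cupPowTwo ℓ j) k =
      ((Nat.factorial k : ℕ) : ℂ)⁻¹ • cupPowTwo (ℓ + B) k := by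
  have hfam : (fun j => ((Nat.factorial j : ℕ) : ℂ)⁻¹ • cupPowTwo ℓ j) =
      fun j => expTwistClasses X ℓ (fun i => ((Nat.factorial i : ℕ) : ℂ)⁻¹ • cupPowTwo (0 : complexBetti X 2) i) j :=
    funext fun j => (expTwistClasses_expFamily_zero ℓ j).symm
  rw [hfam, ← expTwistClasses_add, expTwistClasses_expFamily_zero, add_comm]

/-- The twist commutes with FINITE SUMS of families: `exp(B) ∪ (Σ_a κ_a) = Σ_a exp(B) ∪ κ_a`. [cite: HuybrechtsStellari2005, §1] -/
theorem expTwistClasses_family_sum {ι : Type*} (s : Finset ι) (B : complexBetti X 2)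
    (κ : ι → (j : ℕ) → complexBetti X (2 * j)) (k : ℕ) :
    expTwistClasses X B (fun j => ∑ a ∈ s, κ a j) k = ∑ a ∈ s, expTwistClasses X B (κ a) k := by
  unfold expTwistClasses
  rw [Finset.sum_comm]
  refine Finset.sum_congr rfl fun i _ => ?_
  rw [map_sum, Finset.smul_sum]

/-- **Twisting a sum of exponential families**: `(exp(B) ∪ Σ_a exp(ℓ_a))_k = Σ_a (ℓ_a + B)ᵏ/k!` — the root form of `ch ↦ ch · exp(B)` on a
Chern character that splits into line-bundle exponentials. [cite: HuybrechtsStellari2005, §1] [cite: Fulton1998, Example 3.2.3] -/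
theorem expTwistClasses_sum_expFamily {ι : Type*} (s : Finset ι) (B : complexBetti X 2) (ℓ : ι → complexBetti X 2) (k : ℕ) :
    expTwistClasses X B (fun j => ∑ a ∈ s, ((Nat.factorial j : ℕ) : ℂ)⁻¹ • cupPowTwo (ℓ a) j) k =
      ∑ a ∈ s, ((Nat.factorial k : ℕ) : ℂ)⁻¹ • cupPowTwo (ℓ a + B) k := by
  rw [expTwistClasses_family_sum]
  exact Finset.sum_congr rfl fun a _ => expTwistClasses_expFamily B (ℓ a) k

end Roots

/-! ## §2 Markman's gauge on root data -/

section Markman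

variable (C : ChernCharacterBetti) {X : SchemeOver ℂ} {F : X.left.Modules} {m : ℕ} {ℓ : Fin m → complexBetti X 2}

/-- **`ch₀ = m·1` for root data with `m` roots** (`ch₀ = Σ_a ℓ_a⁰/0! = Σ_a 1`). [cite: Fulton1998, Example 3.2.3] -/
theorem ch_zero_of_roots (hch : ∀ j, C.ch X F j = ∑ a, ((Nat.factorial j : ℕ) : ℂ)⁻¹ • cupPowTwo (ℓ a) j) :
    C.ch X F 0 = ((m : ℚ) : ℂ) • singularCohomology.one ℂ (ComplexPoints X) := by
  rw [hch 0]
  simp only [Nat.factorial_zero, Nat.cast_one, inv_one, one_smul, cupPowTwo_zero, Finset.sum_const, Finset.card_univ,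
    Fintype.card_fin, Rat.cast_natCast, Nat.cast_smul_eq_nsmul]

/-- **`ch₁ = Σ_a ℓ_a` for root data** (`ℓ¹/1! = ℓ`). [cite: Fulton1998, Example 3.2.3] -/
theorem ch_one_of_roots (hch : ∀ j, C.ch X F j = ∑ a, ((Nat.factorial j : ℕ) : ℂ)⁻¹ • cupPowTwo (ℓ a) j) :
    C.ch X F 1 = ∑ a, ℓ a := by
  rw [hch 1]
  simp only [Nat.factorial_one, Nat.cast_one, inv_one, one_smul, cupPowTwo_one]

/-- **The `B`-twisted Chern character of root data is `Σ_a (ℓ_a + B)ᵏ/k!`.** [cite: HuybrechtsStellari2005, §1] [cite: Fulton1998, Example 3.2.3] -/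
theorem expTwistCh_eq_sum_roots (hch : ∀ j, C.ch X F j = ∑ a, ((Nat.factorial j : ℕ) : ℂ)⁻¹ • cupPowTwo (ℓ a) j)
    (B : complexBetti X 2) (k : ℕ) :
    expTwistCh C X B F k = ∑ a, ((Nat.factorial k : ℕ) : ℂ)⁻¹ • cupPowTwo (ℓ a + B) k := by
  rw [expTwistCh_eq_expTwistClasses, show (fun j => C.ch X F j) = _ from funext hch]
  exact expTwistClasses_sum_expFamily Finset.univ B ℓ k

/-- **MARKMAN'S GAUGE ON ROOT DATA = CENTRING THE ROOTS**: for `B_M = −ch₁(F)/m = −(1/m)Σ_b ℓ_b`,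
`κ_k(F) = (exp(B_M) ∪ ch(F))_k = Σ_a μ_aᵏ/k!` with `μ_a = ℓ_a − (1/m)Σ_b ℓ_b` — the `κ`-class `ch(F)·exp(−c₁(F)/r)` of a flag-type object is the sum
of the exponentials of its CENTRED roots (which sum to zero). [cite: Markman2025SecantWeil, §1.1 (κ-class)] [cite: HuybrechtsStellari2005, §1] -/
theorem expTwistCh_markman_eq_sum_centredRoots (hch : ∀ j, C.ch X F j = ∑ a, ((Nat.factorial j : ℕ) : ℂ)⁻¹ • cupPowTwo (ℓ a) j) (k : ℕ) :
    expTwistCh C X (-((((m : ℚ) : ℂ))⁻¹ • C.ch X F 1)) F k =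
      ∑ a, ((Nat.factorial k : ℕ) : ℂ)⁻¹ • cupPowTwo (ℓ a + -(((m : ℂ))⁻¹ • ∑ b, ℓ b)) k := by
  rw [expTwistCh_eq_sum_roots C hch, ch_one_of_roots C hch, Rat.cast_natCast]

end Markman

/-! ## §3 The `(6,3)` find-the-sheaf problem of lane R in flag-root form -/

section SixThree

variable {C : ChernCharacterBetti}

/-- **ELLIPTIC-POWER CARRIERS AT THE PRIMED DOOR FROM FLAG-TYPE `{0,1,2}`-SEMIREGULAR BUNDLES WITH GOOD CENTRED ROOTS.** If on every polarised
`(X, θ)`, `X ≅ A₀ ~ E₀^{N+1}`, `dim A₀ = 6`, every rational algebraic `w ∈ H⁶` admits a finite locally free `F` with `m ≥ 1` Chern roots `ℓ_a`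
(`ch_j(F) = Σ_a ℓ_aʲ/j!`), `{0,1,2}`-semiregular, whose centred roots `μ_a = ℓ_a − (1/m)Σℓ` satisfy `½Σ_a μ_a² = c₂·θ²` and
`(1/6)Σ_a μ_a³ = a·w + c₃·θ³` with `a ≠ 0`, then the elliptic-power carrier statement holds for `tw C AdmTw′` at `(6,3)` — via
`ellipticPowerCarrierAt63_twAdm'_of_forall_exists_markman` (gen 85) and §2. The class conditions are the design memo's (R1)–(R3); its solutions
at `E⁶` (3 diagonal roots for `w = x_j·θ²`; 32 rank-3 roots for the Weil class of `E³ × Ē³`, `κ = 32 − 32·w`) discharge everything here EXCEPT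
the semiregularity of a bundle with those roots. [cite: Markman2025SecantWeil, §1.1, §7.3 and Lemma 9.3.6] [cite: BuchweitzFlenner2003, §5 (I-semiregular) and Thm. 5.1]
[cite: Pridham2024Semiregularity, Cor. 2.25 and Rem. 2.26] [cite: vanGeemen1994HodgeAV, Thm. 4.3] -/
theorem ellipticPowerCarrierAt63_twAdm'_of_forall_exists_flagRoots
    (h : ∀ (X : SchemeOver ℂ) (θ : complexBetti X 2),
      ((∃ (A₀ E₀ : AbelianVariety ℂ) (N : ℕ), A₀.dim = 6 ∧ E₀.dim = 1 ∧ A₀.IsIsogenous (E₀.powSucc N) ∧ Nonempty (A₀.X ≅ X)) ∧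
        IsPolarizationClass 6 X θ) →
      ∀ w : complexBetti X (2 * 3), w ∈ algebraicClasses X 3 → IsRationalClass w →
      ∃ (F : X.left.Modules) (hF : IsFiniteLocallyFree F) (m : ℕ) (ℓ : Fin m → complexBetti X 2) (a c₂ c₃ : ℂ),
        0 < m ∧ (∀ j, C.ch X F j = ∑ b, ((Nat.factorial j : ℕ) : ℂ)⁻¹ • cupPowTwo (ℓ b) j) ∧ IsISemiregular hF (Set.Iio 3) ∧ a ≠ 0 ∧
        ∑ b, ((Nat.factorial 2 : ℕ) : ℂ)⁻¹ • cupPowTwo (ℓ b + -(((m : ℂ))⁻¹ • ∑ b', ℓ b')) 2 = c₂ • cupPowTwo θ 2 ∧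
        ∑ b, ((Nat.factorial 3 : ℕ) : ℂ)⁻¹ • cupPowTwo (ℓ b + -(((m : ℂ))⁻¹ • ∑ b', ℓ b')) 3 = a • w + c₃ • cupPowTwo θ 3) :
    AnchoredCarrierAt (Literature.AlgebraicGeometry.HodgeTheory.twistedReflexiveClass C
        (fun n X₀ I E => Summit.Ventures.HSemireg.gluableSigmaAdmissible n X₀ I E ∨
          Literature.AlgebraicGeometry.HodgeTheory.bfSingleAdmissible' n X₀ I E)) 6 3
      (fun X θ ↦ (∃ (A₀ E₀ : AbelianVariety ℂ) (N : ℕ), A₀.dim = 6 ∧ E₀.dim = 1 ∧ A₀.IsIsogenous (E₀.powSucc N) ∧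
        Nonempty (A₀.X ≅ X)) ∧ IsPolarizationClass 6 X θ)
      (fun X _ ↦ (algebraicClasses X 3 : Set (complexBetti X (2 * 3)))) := by
  refine ellipticPowerCarrierAt63_twAdm'_of_forall_exists_markman fun X θ hXθ w hw hwQ ↦ ?_
  obtain ⟨F, hF, m, ℓ, a, c₂, c₃, hm, hch, hsr, ha, h2, h3⟩ := h X θ hXθ w hw hwQ
  refine ⟨F, hF, (m : ℚ), a, c₂, c₃, by exact_mod_cast hm.ne', ch_zero_of_roots C hch, hsr, ha, ?_, ?_⟩
  · rw [expTwistCh_markman_eq_sum_centredRoots C hch]; exact h2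
  · rw [expTwistCh_markman_eq_sum_centredRoots C hch]; exact h3

/-- **THE SAME AT LEFSCHETZ-FIBRE SIXFOLDS** (`X ≅ A₀`, `B•(A₀) = D•(A₀)`, served classes the rational Lefschetz classes `w ∈ D³(X) ⊗ ℂ`): flag-type
`{0,1,2}`-semiregular `F` with `½Σμ_a² = c₂·θ²`, `(1/6)Σμ_a³ = a·w + c₃·θ³`, `a ≠ 0` ⟹ the Lefschetz-fibre carrier statement for `tw C AdmTw′`
(via `lefschetzCarrierAt63_twAdm'_of_forall_exists_markman`). [cite: Markman2025SecantWeil, §1.1, §7.3 and Lemma 9.3.6]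
[cite: BuchweitzFlenner2003, §5 (I-semiregular) and Thm. 5.1] [cite: MoonenZarhin1999LowDim, §2 (2.2)] [cite: vanGeemen1994HodgeAV, §2.4] -/
theorem lefschetzCarrierAt63_twAdm'_of_forall_exists_flagRoots
    (h : ∀ (X : SchemeOver ℂ) (θ : complexBetti X 2),
      ((∃ A₀ : AbelianVariety ℂ, A₀.dim = 6 ∧ IsDivisorGenerated A₀ ∧ Nonempty (A₀.X ≅ X)) ∧ IsPolarizationClass 6 X θ) →
      ∀ w : complexBetti X (2 * 3), w ∈ divisorClassesSpan X 6 3 → IsRationalClass w →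
      ∃ (F : X.left.Modules) (hF : IsFiniteLocallyFree F) (m : ℕ) (ℓ : Fin m → complexBetti X 2) (a c₂ c₃ : ℂ),
        0 < m ∧ (∀ j, C.ch X F j = ∑ b, ((Nat.factorial j : ℕ) : ℂ)⁻¹ • cupPowTwo (ℓ b) j) ∧ IsISemiregular hF (Set.Iio 3) ∧ a ≠ 0 ∧
        ∑ b, ((Nat.factorial 2 : ℕ) : ℂ)⁻¹ • cupPowTwo (ℓ b + -(((m : ℂ))⁻¹ • ∑ b', ℓ b')) 2 = c₂ • cupPowTwo θ 2 ∧
        ∑ b, ((Nat.factorial 3 : ℕ) : ℂ)⁻¹ • cupPowTwo (ℓ b + -(((m : ℂ))⁻¹ • ∑ b', ℓ b')) 3 = a • w + c₃ • cupPowTwo θ 3) :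
    AnchoredCarrierAt (Literature.AlgebraicGeometry.HodgeTheory.twistedReflexiveClass C
        (fun n X₀ I E => Summit.Ventures.HSemireg.gluableSigmaAdmissible n X₀ I E ∨
          Literature.AlgebraicGeometry.HodgeTheory.bfSingleAdmissible' n X₀ I E)) 6 3
      (fun X θ ↦ (∃ A₀ : AbelianVariety ℂ, A₀.dim = 6 ∧ IsDivisorGenerated A₀ ∧ Nonempty (A₀.X ≅ X)) ∧ IsPolarizationClass 6 X θ)
      (fun X _ ↦ (algebraicClasses X 3 : Set (complexBetti X (2 * 3)))) := by
  refine lefschetzCarrierAt63_twAdm'_of_forall_exists_markman fun X θ hXθ w hw hwQ ↦ ?_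
  obtain ⟨F, hF, m, ℓ, a, c₂, c₃, hm, hch, hsr, ha, h2, h3⟩ := h X θ hXθ w hw hwQ
  refine ⟨F, hF, (m : ℚ), a, c₂, c₃, by exact_mod_cast hm.ne', ch_zero_of_roots C hch, hsr, ha, ?_, ?_⟩
  · rw [expTwistCh_markman_eq_sum_centredRoots C hch]; exact h2
  · rw [expTwistCh_markman_eq_sum_centredRoots C hch]; exact h3

end SixThree

end Summit.HodgeConjecture.HodgeConjecture.Ring2.SemiregularRepresentatives

end
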